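import Summits.AtomisticToContinuum.HydrodynamicLimit.Theorems.JParityClosureLocalSecondLawEquilibriumDetIdentity
import Summits.AtomisticToContinuum.HydrodynamicLimit.Theorems.JParityClosureLocalSecondLawEquilibriumPinning
import Summits.AtomisticToContinuum.HydrodynamicLimit.Theorems.JParityClosureLocalSecondLawEquilibriumUniformLLN
import Summits.AtomisticToContinuum.HydrodynamicLimit.Theorems.JParityClosureLocalSecondLawEquilibriumSupDensity
import Summits.AtomisticToContinuum.HydrodynamicLimit.Theorems.JParityClosureLocalSecondLawEquilibriumTimeAverage
import Summits.AtomisticToContinuum.HydrodynamicLimit.Theorems.JParityClosureLocalSecondLawEquilibriumModulus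
import Summits.AtomisticToContinuum.HydrodynamicLimit.Theorems.JParityClosureLocalSecondLawEquilibriumMajorant
import Summits.AtomisticToContinuum.HydrodynamicLimit.Theorems.JParityClosureLocalSecondLawEquilibriumEnergyMoment
import Summits.AtomisticToContinuum.HydrodynamicLimit.Theorems.JParityClosureLocalSecondLawEquilibriumColdBallsAssembly
import Summits.AtomisticToContinuum.HydrodynamicLimit.Theorems.JParityClosureLocalSecondLawThermalHeatFluxBounds

/-!
# The local second law at global equilibrium: `localSecondLaw_const` (registered stub, lead c3)

Equilibrium side-composition of line `exact-entropy-ledger-three-passivities` for the crux `JParityClosure.LocalSecondLaw`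
(stmt-AtomisticToContinuum-13081): the crux body VERBATIM at constant profiles `(a, ū, Θ)` (homogeneous local Gibbs law
`lawC σ a Θ ū N Φ`), composed from the nine landed equilibrium stubs `eq_detIdentity`, `eq_pinning`, `eq_uniformLLN`,
`eq_supDensity`, `eq_timeAverage`, `eq_modulus`, `eq_majorant`, `eq_energyMoment`, `eq_coldBalls` and the PROVED route item
`HsEosLowDensity` (EOS band); outline in the docstring of `localSecondLaw_const`.  References: H. Spohn, *Large Scale
Dynamics of Interacting Particles* (1991), Part I §2.3; C. Kipnis, C. Landim, *Scaling Limits …* (1999), Appendix 1 §8. -/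

noncomputable section

open scoped BigOperators Topology Classical MeasureTheory ENNReal InnerProductSpace
open Filter Set MeasureTheory Literature.MathematicalPhysics.KineticTheory Literature.Analysis.FluidPDE

namespace Summit.AtomisticToContinuum.HydrodynamicLimit.Theorems.LocalSecondLawEquilibrium

open Summit.AtomisticToContinuum.HydrodynamicLimit.Theses Summit.AtomisticToContinuum.HydrodynamicLimit.Theorems.LocalSecondLawNegative
  Summit.AtomisticToContinuum.HydrodynamicLimit.Theorems.LocalSecondLawLedger

variable {N : ℕ}

/-! ## Deterministic pieces of the composition -/

/-- Pointwise comparison of the cut crux integrand with its constant-state value: with `M` a bound of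
`|∂ₛφ(s,x)|` and of every `|∂ₖφ(s,x)|`, `|X̃ − X_det| ≤ M · Ystat`. -/
theorem abs_Xtil_sub_Xdet_le {σ Θ r : ℝ} {ū : V3} {φ : ℝ → T3 → ℝ} {s : ℝ} {w : Phase N} {x : T3}
    {M : ℝ} (hd : |deriv (fun s' => φ s' x) s| ≤ M) (hp : ∀ k : Fin 3, |pD k (φ s) x| ≤ M) :
    |Xtil σ r φ s w x - Xdet σ Θ ū φ s x| ≤ M * Ystat σ Θ ū r w x := by
  have hsum : HsT σ r w x * (∑ k : Fin 3, momC r w x k / rhoC r w x * pD k (φ s) x) -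
      Hs σ 1 Θ * (∑ k : Fin 3, ū k * pD k (φ s) x) =
        ∑ k : Fin 3, (HsT σ r w x * (momC r w x k / rhoC r w x) - Hs σ 1 Θ * ū k) * pD k (φ s) x := by
    rw [Finset.mul_sum, Finset.mul_sum, ← Finset.sum_sub_distrib]
    exact Finset.sum_congr rfl fun k _ => by ring
  have hsplit : Xtil σ r φ s w x - Xdet σ Θ ū φ s x =
      (HsT σ r w x - Hs σ 1 Θ) * deriv (fun s' => φ s' x) s +
        ∑ k : Fin 3, (HsT σ r w x * (momC r w x k / rhoC r w x) - Hs σ 1 Θ * ū k) * pD k (φ s) x := by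
    rw [← hsum, Xtil, Xdet]
    ring
  rw [hsplit, Ystat, mul_add, Finset.mul_sum]
  refine (abs_add_le _ _).trans (add_le_add ?_ ?_)
  · rw [abs_mul, mul_comm M]
    exact mul_le_mul_of_nonneg_left hd (abs_nonneg _)
  · refine (Finset.abs_sum_le_sum_abs _ _).trans (Finset.sum_le_sum fun k _ => ?_)
    rw [abs_mul, mul_comm M]
    exact mul_le_mul_of_nonneg_left (hp k) (abs_nonneg _)

/-- Uniform bounds of `∂ₛφ` and `∇φ` on `[0, τ] × 𝕋³` for a jointly smooth test function. -/
theorem exists_deriv_bounds {φ : ℝ → T3 → ℝ}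
    (hφ : Literature.Analysis.FunctionSpaces.Torus.IsSmoothSpaceTimeOn Set.univ φ) (τ : ℝ) :
    ∃ M : ℝ, 0 ≤ M ∧ (∀ s ∈ Set.Icc (0 : ℝ) τ, ∀ x, |deriv (fun s' => φ s' x) s| ≤ M) ∧
      ∀ s ∈ Set.Icc (0 : ℝ) τ, ∀ x, ∀ k : Fin 3, |pD k (φ s) x| ≤ M := by
  obtain ⟨M₀, M', -, hM', -, hgrad⟩ := psvT_phi_bounds hφ τ
  obtain ⟨C, hC⟩ := (hφ.timeDerivWithin uniqueDiffOn_univ).exists_norm_le_of_isCompact isCompact_Icc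
    (Set.subset_univ (Set.Icc (0 : ℝ) τ))
  refine ⟨max |C| M', le_max_of_le_right hM', fun s hs x => ?_, fun s hs x k => (hgrad s hs x k).trans (le_max_right _ _)⟩
  have h1 : deriv (fun s' => φ s' x) s = Literature.Analysis.FunctionSpaces.Torus.timeDerivWithin Set.univ φ s x := by
    simp [Literature.Analysis.FunctionSpaces.Torus.timeDerivWithin, derivWithin_univ]
  rw [h1, ← Real.norm_eq_abs]
  exact ((hC s hs x).trans (le_abs_self C)).trans (le_max_left _ _)

/-! ## The static `L¹` estimate at one field point -/

/-- **Static split.**  Under a probability law `μ` on phase space: if `Ystat < ε₁` off a measurable set `B` of mass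
`≤ δ'`, `Ystat ≤ C₁(1 + e_r + coldTerm)` everywhere, `E[e_r²] ≤ C₂` and `E[coldTerm] ≤ ε₂`, then for every `K > 0`,
`E[Ystat] ≤ ε₁ + C₁((1 + K/2)δ' + C₂/(2K) + ε₂)`. -/
theorem lintegral_Ystat_le {σ Θ r : ℝ} {ū : V3} {x : T3} (μ : Measure (Phase N)) [IsProbabilityMeasure μ]
    {B : Set (Phase N)} (hBm : MeasurableSet B) {ε₁ δ' C₁ C₂ ε₂ K : ℝ} (hε₁ : 0 ≤ ε₁) (hδ' : 0 ≤ δ')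
    (hC₁ : 0 ≤ C₁) (hC₂ : 0 ≤ C₂) (hε₂ : 0 ≤ ε₂) (hK : 0 < K) (hr : 0 < r)
    (hB : μ B ≤ ENNReal.ofReal δ')
    (hoff : ∀ w, w ∉ B → Ystat σ Θ ū r w x < ε₁)
    (hmaj : ∀ w : Phase N, Ystat σ Θ ū r w x ≤ C₁ * (1 + kinC r w x + coldTerm Θ r w x))
    (hE : ∫⁻ w, ENNReal.ofReal (kinC r w x ^ 2) ∂μ ≤ ENNReal.ofReal C₂)
    (hcold : ∫⁻ w, ENNReal.ofReal (coldTerm Θ r w x) ∂μ ≤ ENNReal.ofReal ε₂) :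
    ∫⁻ w, ENNReal.ofReal (Ystat σ Θ ū r w x) ∂μ ≤
      ENNReal.ofReal (ε₁ + C₁ * ((1 + K / 2) * δ' + C₂ / (2 * K) + ε₂)) := by
  -- split along B
  rw [← lintegral_add_compl (fun w => ENNReal.ofReal (Ystat σ Θ ū r w x)) hBm]
  -- off B
  have hoff' : ∫⁻ w in Bᶜ, ENNReal.ofReal (Ystat σ Θ ū r w x) ∂μ ≤ ENNReal.ofReal ε₁ := by
    calc ∫⁻ w in Bᶜ, ENNReal.ofReal (Ystat σ Θ ū r w x) ∂μ
        ≤ ∫⁻ w in Bᶜ, ENNReal.ofReal ε₁ ∂μ :=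
          setLIntegral_mono' hBm.compl fun w hw => ENNReal.ofReal_le_ofReal (hoff w hw).le
      _ = ENNReal.ofReal ε₁ * μ Bᶜ := setLIntegral_const _ _
      _ ≤ ENNReal.ofReal ε₁ * 1 := mul_le_mul_right prob_le_one _
      _ = ENNReal.ofReal ε₁ := mul_one _
  -- on B: the majorant, then AM–GM for the energy
  have hon : ∫⁻ w in B, ENNReal.ofReal (Ystat σ Θ ū r w x) ∂μ ≤
      ENNReal.ofReal (C₁ * ((1 + K / 2) * δ' + C₂ / (2 * K) + ε₂)) := by
    have hpt : ∀ w : Phase N, ENNReal.ofReal (Ystat σ Θ ū r w x) ≤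
        ENNReal.ofReal C₁ * (ENNReal.ofReal (1 + K / 2) + ENNReal.ofReal (kinC r w x ^ 2 / (2 * K)) +
          ENNReal.ofReal (coldTerm Θ r w x)) := by
      intro w
      have hk := kinC_nonneg hr w x
      have hc := coldTerm_nonneg (Θ := Θ) hr w x
      have h1 : Ystat σ Θ ū r w x ≤ C₁ * ((1 + K / 2) + kinC r w x ^ 2 / (2 * K) + coldTerm Θ r w x) := by
        refine (hmaj w).trans (mul_le_mul_of_nonneg_left ?_ hC₁)
        have hamgm : kinC r w x ≤ K / 2 + kinC r w x ^ 2 / (2 * K) := by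
          rw [div_add_div _ _ two_ne_zero (by positivity), le_div_iff₀ (by positivity)]
          nlinarith [sq_nonneg (kinC r w x - K)]
        linarith
      calc ENNReal.ofReal (Ystat σ Θ ū r w x)
          ≤ ENNReal.ofReal (C₁ * ((1 + K / 2) + kinC r w x ^ 2 / (2 * K) + coldTerm Θ r w x)) :=
            ENNReal.ofReal_le_ofReal h1
        _ = _ := by
            rw [ENNReal.ofReal_mul hC₁, ENNReal.ofReal_add (by positivity) hc,
              ENNReal.ofReal_add (by positivity) (by positivity)]
    have hmeasE : Measurable fun w : Phase N => ENNReal.ofReal (kinC r w x ^ 2 / (2 * K)) := by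
      have hkc : Continuous fun w : Phase N => kinC r w x := by
        have h := (continuous_kinC_uncurry (N := N) r).comp (Continuous.prodMk_left x)
        simpa only [Function.comp_def] using h
      exact ((hkc.measurable.pow_const 2).div_const _).ennreal_ofReal
    calc ∫⁻ w in B, ENNReal.ofReal (Ystat σ Θ ū r w x) ∂μ
        ≤ ∫⁻ w in B, ENNReal.ofReal C₁ * (ENNReal.ofReal (1 + K / 2) + ENNReal.ofReal (kinC r w x ^ 2 / (2 * K)) +
            ENNReal.ofReal (coldTerm Θ r w x)) ∂μ := setLIntegral_mono' hBm fun w _ => hpt w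
      _ = ENNReal.ofReal C₁ * ∫⁻ w in B, (ENNReal.ofReal (1 + K / 2) + ENNReal.ofReal (kinC r w x ^ 2 / (2 * K)) +
            ENNReal.ofReal (coldTerm Θ r w x)) ∂μ := lintegral_const_mul' _ _ ENNReal.ofReal_ne_top
      _ = ENNReal.ofReal C₁ * ((∫⁻ w in B, ENNReal.ofReal (1 + K / 2) ∂μ) +
            (∫⁻ w in B, ENNReal.ofReal (kinC r w x ^ 2 / (2 * K)) ∂μ) +
            ∫⁻ w in B, ENNReal.ofReal (coldTerm Θ r w x) ∂μ) := by
          congr 1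
          have hm2 : Measurable fun w : Phase N =>
              ENNReal.ofReal (1 + K / 2) + ENNReal.ofReal (kinC r w x ^ 2 / (2 * K)) :=
            measurable_const.add hmeasE
          rw [lintegral_add_left hm2, lintegral_add_left measurable_const]
      _ ≤ ENNReal.ofReal C₁ * (ENNReal.ofReal (1 + K / 2) * ENNReal.ofReal δ' +
            ENNReal.ofReal (C₂ / (2 * K)) + ENNReal.ofReal ε₂) := by
          refine mul_le_mul_right (add_le_add (add_le_add ?_ ?_) ?_) _
          · rw [setLIntegral_const]
            exact mul_le_mul_right hB _
          · calc ∫⁻ w in B, ENNReal.ofReal (kinC r w x ^ 2 / (2 * K)) ∂μ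
                ≤ ∫⁻ w, ENNReal.ofReal (kinC r w x ^ 2 / (2 * K)) ∂μ := setLIntegral_le_lintegral _ _
              _ = ∫⁻ w, ENNReal.ofReal (2 * K)⁻¹ * ENNReal.ofReal (kinC r w x ^ 2) ∂μ := by
                  refine lintegral_congr fun w => ?_
                  rw [← ENNReal.ofReal_mul (by positivity), div_eq_inv_mul]
              _ = ENNReal.ofReal (2 * K)⁻¹ * ∫⁻ w, ENNReal.ofReal (kinC r w x ^ 2) ∂μ :=
                  lintegral_const_mul' _ _ ENNReal.ofReal_ne_top
              _ ≤ ENNReal.ofReal (2 * K)⁻¹ * ENNReal.ofReal C₂ := mul_le_mul_right hE _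
              _ = ENNReal.ofReal (C₂ / (2 * K)) := by
                  rw [← ENNReal.ofReal_mul (by positivity), div_eq_inv_mul]
          · exact (setLIntegral_le_lintegral _ _).trans hcold
      _ = ENNReal.ofReal (C₁ * ((1 + K / 2) * δ' + C₂ / (2 * K) + ε₂)) := by
          rw [← ENNReal.ofReal_mul (by positivity), ← ENNReal.ofReal_add (by positivity) (by positivity),
            ← ENNReal.ofReal_add (by positivity) hε₂, ← ENNReal.ofReal_mul hC₁]
  calc (∫⁻ w in B, ENNReal.ofReal (Ystat σ Θ ū r w x) ∂μ) + ∫⁻ w in Bᶜ, ENNReal.ofReal (Ystat σ Θ ū r w x) ∂μ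
      ≤ ENNReal.ofReal (C₁ * ((1 + K / 2) * δ' + C₂ / (2 * K) + ε₂)) + ENNReal.ofReal ε₁ := add_le_add hon hoff'
    _ = ENNReal.ofReal (ε₁ + C₁ * ((1 + K / 2) * δ' + C₂ / (2 * K) + ε₂)) := by
        rw [← ENNReal.ofReal_add (by positivity) hε₁, add_comm]

/-! ## The space–time bound -/

/-- **Space–time integration of the static bound.**  If at every `(s, x) ∈ [0,τ] × 𝕋³` the static expectation
`E|X̃(s,·,x) − X_det(s,x)|` is at most `Y`, then its space–time integral is at most `τ · Y`. -/
theorem lintegral_spaceTime_le {τ Y : ℝ} (hY : 0 ≤ Y) (μ : Measure (Phase N))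
    (G : ℝ → Phase N → T3 → ℝ≥0∞)
    (h : ∀ s ∈ Set.Icc (0 : ℝ) τ, ∀ x : T3, ∫⁻ w, G s w x ∂μ ≤ ENNReal.ofReal Y) :
    ∫⁻ s in Set.Icc (0 : ℝ) τ, ∫⁻ x : T3, ∫⁻ w, G s w x ∂μ ≤ ENNReal.ofReal (τ * Y) := by
  calc ∫⁻ s in Set.Icc (0 : ℝ) τ, ∫⁻ x : T3, ∫⁻ w, G s w x ∂μ
      ≤ ∫⁻ s in Set.Icc (0 : ℝ) τ, ENNReal.ofReal Y := by
        refine setLIntegral_mono' measurableSet_Icc fun s hs => ?_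
        calc ∫⁻ x : T3, ∫⁻ w, G s w x ∂μ ≤ ∫⁻ x : T3, ENNReal.ofReal Y := lintegral_mono fun x => h s hs x
          _ = ENNReal.ofReal Y := by rw [lintegral_const, measure_univ, mul_one]
    _ = ENNReal.ofReal Y * volume (Set.Icc (0 : ℝ) τ) := setLIntegral_const _ _
    _ = ENNReal.ofReal (τ * Y) := by
        rw [Real.volume_Icc, sub_zero, ← ENNReal.ofReal_mul hY, mul_comm]

/-! ## The composition: the crux body VERBATIM at constant profiles -/

/-- Budget arithmetic of the composition (pure real inequalities): with `K = 2(C₁C₂+1)/κ`,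
`δ' = κ/(4(C₁+1)(1+K/2))`, `ε₂ = κ/(4(C₁+1))`, the static split bound is at most `κ`. -/
theorem budget_arith {κ C₁ C₂ K δ' ε₂ : ℝ} (hκ : 0 < κ) (hC₁ : 0 ≤ C₁) (hC₂ : 0 ≤ C₂)
    (hKd : K = 2 * (C₁ * C₂ + 1) / κ) (hδd : δ' = κ / (4 * (C₁ + 1) * (1 + K / 2))) (hεd : ε₂ = κ / (4 * (C₁ + 1))) :
    0 < K ∧ 0 < δ' ∧ 0 < ε₂ ∧ κ / 4 + C₁ * ((1 + K / 2) * δ' + C₂ / (2 * K) + ε₂) ≤ κ := by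
  have hK : 0 < K := by rw [hKd]; positivity
  have hδ' : 0 < δ' := by rw [hδd]; positivity
  have hε₂ : 0 < ε₂ := by rw [hεd]; positivity
  refine ⟨hK, hδ', hε₂, ?_⟩
  have hfrac : C₁ / (C₁ + 1) ≤ 1 := (div_le_one (by positivity)).2 (by linarith)
  have h1 : C₁ * ((1 + K / 2) * δ') ≤ κ / 4 := by
    have : C₁ * ((1 + K / 2) * δ') = κ / 4 * (C₁ / (C₁ + 1)) := by
      rw [hδd]
      field_simp
    rw [this]
    calc κ / 4 * (C₁ / (C₁ + 1)) ≤ κ / 4 * 1 := mul_le_mul_of_nonneg_left hfrac (by positivity)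
      _ = κ / 4 := mul_one _
  have h2 : C₁ * (C₂ / (2 * K)) ≤ κ / 4 := by
    have : C₁ * (C₂ / (2 * K)) = κ / 4 * (C₁ * C₂ / (C₁ * C₂ + 1)) := by
      rw [hKd]
      field_simp
      ring
    rw [this]
    have hle : C₁ * C₂ / (C₁ * C₂ + 1) ≤ 1 := (div_le_one (by positivity)).2 (by linarith)
    calc κ / 4 * (C₁ * C₂ / (C₁ * C₂ + 1)) ≤ κ / 4 * 1 := mul_le_mul_of_nonneg_left hle (by positivity)
      _ = κ / 4 := mul_one _
  have h3 : C₁ * ε₂ ≤ κ / 4 := by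
    have : C₁ * ε₂ = κ / 4 * (C₁ / (C₁ + 1)) := by
      rw [hεd]
      field_simp
    rw [this]
    calc κ / 4 * (C₁ / (C₁ + 1)) ≤ κ / 4 * 1 := mul_le_mul_of_nonneg_left hfrac (by positivity)
      _ = κ / 4 := mul_one _
  have : C₁ * ((1 + K / 2) * δ' + C₂ / (2 * K) + ε₂) =
      C₁ * ((1 + K / 2) * δ') + C₁ * (C₂ / (2 * K)) + C₁ * ε₂ := by ring
  rw [this]
  linarith

/-- **Registered stub `localSecondLaw_const` — the global-equilibrium instance of the crux `JParityClosure.LocalSecondLaw`.**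
For constant profiles `(a, ū, Θ)` (homogeneous local Gibbs data) the crux body holds verbatim, for EVERY horizon `τ`:
the local entropy inequality in probability for the cone-mollified empirical fields with the full hard-sphere entropy
(including `f_ex` and the guard), in the filed limit order.  Composition of the nine equilibrium stubs: the Euler data are
pinned to `(1, ū, Θ)` by the `t = 0` LLN (`eq_pinning`), so the boundary term is `H̄ ∫φ(0)` and cancels the deterministic
space–time value (`eq_detIdentity`); on the sup-density event (`eq_supDensity`, fed by the density third of
`eq_uniformLLN`) the crux functional is the cut functional `Ĩ`; Markov and `eq_timeAverage` (Tonelli + flow-invariance of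
the homogeneous law) reduce `P(|Ĩ − I_det| ≥ η)` to static expectations `E|X̃ − X_det| ≤ M·E[Ystat]` at single field
points, and `E[Ystat] ≤ κ` by the split `eq_modulus` (off a small set of `eq_uniformLLN`) + `eq_majorant` with
`eq_energyMoment` (AM–GM) and `eq_coldBalls` (on it).  The EOS band is the PROVED route item `HsEosLowDensity`. -/
theorem localSecondLaw_const : ∀ (a Θ : ℝ) (ū : V3), 0 < a → 0 < Θ → ∃ σ₀ : ℝ, 0 < σ₀ ∧ ∀ σ : ℝ, 0 < σ → σ < σ₀ → ∀ (T : ℝ) (ρ θ : ℝ → T3 → ℝ) (u : ℝ → T3 → V3), IsHardSphereEulerSolution σ T ρ u θ → ∀ Φ : (N : ℕ) → Flow σ N, TendstoHydroFieldsAt (fun N => lawC σ a Θ ū N (Φ N)) Φ ρ u θ 0 → 0 < T → ∀ τ : ℝ, 0 < τ → ∀ φ : ℝ → T3 → ℝ, Literature.Analysis.FunctionSpaces.Torus.IsSmoothSpaceTimeOn Set.univ φ → (∀ s x, 0 ≤ φ s x) → (∃ τ' : ℝ, τ' < τ ∧ ∀ s, τ' ≤ s → ∀ x, φ s x = 0)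 → ∀ η δ : ℝ, 0 < η → 0 < δ → ∃ r₀ : ℝ, 0 < r₀ ∧ ∀ r : ℝ, 0 < r → r < r₀ → ∃ N₀ : ℕ, ∀ N : ℕ, N₀ ≤ N → lawC σ a Θ ū N (Φ N) {z | entropyFunctional σ r τ φ (Φ N) z + ∫ x : T3, Hs σ (ρ 0 x) (θ 0 x) * φ 0 x < -η} ≤ ENNReal.ofReal δ := by
  intro a Θ ū ha hΘ
  -- the EOS band (route item HsEosLowDensity, PROVED) and the frame thresholds
  have hEos := _root_.Summit.AtomisticToContinuum.HydrodynamicLimit.Theorems.hsEosLowDensity_proof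
  unfold Theses.ImplosionDichotomy.HsEosLowDensity at hEos
  obtain ⟨η₀, hη₀, F, hFan, hFeq, -, -, -⟩ := hEos
  have hband : EosBand η₀ F := ⟨hη₀, hFan, hFeq⟩
  obtain ⟨σP, hσP, HP⟩ := eq_pinning a Θ ū ha hΘ
  obtain ⟨σL, hσL, hσLhalf, HL⟩ := eq_uniformLLN a Θ ū ha hΘ
  have hσE : (0 : ℝ) < min 1 (η₀ / 3) := lt_min one_pos (by positivity)
  refine ⟨min (min σP σL) (min 1 (η₀ / 3)), lt_min (lt_min hσP hσL) hσE, ?_⟩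
  intro σ hσ hσlt T ρ θ u hE Φ h0 hT τ hτ φ hφ _hφ0 hsupp η δ hη hδ
  have hσP' : σ < σP := lt_of_lt_of_le hσlt ((min_le_left _ _).trans (min_le_left _ _))
  have hσL' : σ < σL := lt_of_lt_of_le hσlt ((min_le_left _ _).trans (min_le_right _ _))
  have hσ1 : σ < 1 := lt_of_lt_of_le hσlt ((min_le_right _ _).trans (min_le_left _ _))
  have hσ3e : σ < η₀ / 3 := lt_of_lt_of_le hσlt ((min_le_right _ _).trans (min_le_right _ _))
  have hσhalf : σ ≤ 1 / 2 := (hσL'.trans_le hσLhalf).le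
  have hσcube : σ ^ 3 ≤ σ := by
    calc σ ^ 3 = σ * (σ * σ) := by ring
      _ ≤ σ * (1 * 1) := mul_le_mul_of_nonneg_left (mul_le_mul hσ1.le hσ1.le hσ.le zero_le_one) hσ.le
      _ = σ := by ring
  have hσ3 : 3 * σ ^ 3 < η₀ := by linarith
  have hσ3' : σ ^ 3 < η₀ := by nlinarith [pow_pos hσ 3]
  -- pinning of the Euler data: the boundary term, and the deterministic identity
  obtain ⟨hρ0, -, hθ0⟩ := HP σ hσ hσP' T ρ θ u hE hT Φ h0
  have hbdry : ∫ x : T3, Hs σ (ρ 0 x) (θ 0 x) * φ 0 x = Hs σ 1 Θ * ∫ x : T3, φ 0 x := by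
    simp_rw [hρ0, hθ0]
    exact integral_const_mul _ _
  have hdet : Idet σ Θ ū τ φ = -(Hs σ 1 Θ * ∫ x : T3, φ 0 x) :=
    eq_detIdentity (Hs σ 1 Θ) τ ū φ hτ hφ hsupp
  -- derivative bounds of the test function on [0,τ] × 𝕋³ and the per-point budget κ
  obtain ⟨Mb, hMb, hMd, hMp⟩ := exists_deriv_bounds hφ τ
  have hM : (0 : ℝ) < Mb + 1 := by positivity
  have hMd' : ∀ s ∈ Set.Icc (0 : ℝ) τ, ∀ x, |deriv (fun s' => φ s' x) s| ≤ Mb + 1 :=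
    fun s hs x => (hMd s hs x).trans (by linarith)
  have hMp' : ∀ s ∈ Set.Icc (0 : ℝ) τ, ∀ x, ∀ k : Fin 3, |pD k (φ s) x| ≤ Mb + 1 :=
    fun s hs x k => (hMp s hs x k).trans (by linarith)
  set κ : ℝ := η * (δ / 2) / (τ * (Mb + 1)) with hκ_def
  have hκ : 0 < κ := by positivity
  have hκid : τ * ((Mb + 1) * κ) = η * (δ / 2) := by
    rw [hκ_def]; field_simp
  -- static constants independent of the resolution
  obtain ⟨C₁, hC₁, Hmaj⟩ := eq_majorant η₀ F hband σ Θ ū hσ hσ3 hΘ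
  obtain ⟨ι, hι, Hmod⟩ := eq_modulus η₀ F hband σ Θ ū hσ hσ3' hΘ (κ / 4) (by positivity)
  -- the resolution: any r < 1/2
  refine ⟨1 / 2, by norm_num, ?_⟩
  intro r hr hrhalf
  obtain ⟨C₂, hC₂, HE⟩ := eq_energyMoment a Θ σ r ū ha hΘ hσ hσhalf hr
  obtain ⟨hK, hδ', hε₂, hbud⟩ := budget_arith (K := 2 * (C₁ * C₂ + 1) / κ)
    (δ' := κ / (4 * (C₁ + 1) * (1 + 2 * (C₁ * C₂ + 1) / κ / 2))) (ε₂ := κ / (4 * (C₁ + 1))) hκ hC₁ hC₂ rfl rfl rfl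
  set K : ℝ := 2 * (C₁ * C₂ + 1) / κ with hK_def
  set δ' : ℝ := κ / (4 * (C₁ + 1) * (1 + K / 2)) with hδ'_def
  set ε₂ : ℝ := κ / (4 * (C₁ + 1)) with hε₂_def
  -- thresholds in N
  obtain ⟨NL, HNL⟩ := HL σ hσ hσL' r hr hrhalf ι δ' hι hδ'
  obtain ⟨Nc, HNc⟩ := eq_coldBalls a Θ σ r ū ha hΘ hσ hσhalf hr hrhalf ε₂ hε₂
  have hdens : ∀ ι δ' : ℝ, 0 < ι → 0 < δ' → ∃ N₀ : ℕ, ∀ N : ℕ, N₀ ≤ N → ∀ Φ : Flow σ N,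
      ∃ B : Set (Phase N), MeasurableSet B ∧ lawC σ a Θ ū N Φ B ≤ ENNReal.ofReal δ' ∧
        ∀ w, w ∉ B → ∀ x : T3, |rhoC r w x - 1| < ι := by
    intro ι₁ δ₁ hι₁ hδ₁
    obtain ⟨N₀, H⟩ := HL σ hσ hσL' r hr hrhalf ι₁ δ₁ hι₁ hδ₁
    refine ⟨N₀, fun N hN Φ' => ?_⟩
    obtain ⟨B, hBm, hB, hoff⟩ := H N hN Φ'
    exact ⟨B, hBm, hB, fun w hw x => (hoff w hw x).1⟩
  obtain ⟨ND, HND⟩ := eq_supDensity a Θ σ r τ ū ha hΘ hσ hσhalf hr hτ hdens (δ / 2) (by positivity)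
  refine ⟨max NL (max Nc ND), fun N hN => ?_⟩
  have hNL : NL ≤ N := (le_max_left _ _).trans hN
  have hNc : Nc ≤ N := ((le_max_left _ _).trans (le_max_right _ _)).trans hN
  have hND : ND ≤ N := ((le_max_right _ _).trans (le_max_right _ _)).trans hN
  haveI hprob : IsProbabilityMeasure (lawC σ a Θ ū N (Φ N)) :=
    isProbabilityMeasure_localGibbsLaw continuous_const continuous_const continuous_const
      (fun _ => ha) (fun _ => hΘ) hσhalf N (Φ N)
  -- the static estimate at every field point
  obtain ⟨B, hBm, hB, hoffB⟩ := HNL N hNL (Φ N)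
  have hY : ∀ x : T3, ∫⁻ w, ENNReal.ofReal (Ystat σ Θ ū r w x) ∂(lawC σ a Θ ū N (Φ N)) ≤ ENNReal.ofReal κ := by
    intro x
    have h := lintegral_Ystat_le (σ := σ) (Θ := Θ) (ū := ū) (x := x) (lawC σ a Θ ū N (Φ N)) hBm
      (by positivity : (0 : ℝ) ≤ κ / 4) hδ'.le hC₁ hC₂ hε₂.le hK hr hB
      (fun w hw => Hmod N r w x (hoffB w hw x).1 (hoffB w hw x).2.1 (hoffB w hw x).2.2)
      (fun w => Hmaj N r w x hr) (HE N (Φ N) x) (HNc N hNc (Φ N) x)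
    exact h.trans (ENNReal.ofReal_le_ofReal hbud)
  -- the space–time L¹ bound (Tonelli + invariance inside `eq_timeAverage`) and Markov
  obtain ⟨g, hgm, hgae, hgint⟩ := eq_timeAverage η₀ F hband a Θ σ r τ ū φ ha hΘ hσ hσhalf hσ3 hr hτ hφ N (Φ N)
  have hL1 : ∫⁻ z, g z ∂(lawC σ a Θ ū N (Φ N)) ≤ ENNReal.ofReal (η * (δ / 2)) := by
    refine hgint.trans ?_
    rw [← hκid]
    refine lintegral_spaceTime_le (N := N) (τ := τ) (Y := (Mb + 1) * κ) (by positivity) (lawC σ a Θ ū N (Φ N))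
      (fun s w x => ENNReal.ofReal |Xtil σ r φ s w x - Xdet σ Θ ū φ s x|) fun s hs x => ?_
    calc ∫⁻ w, ENNReal.ofReal |Xtil σ r φ s w x - Xdet σ Θ ū φ s x| ∂(lawC σ a Θ ū N (Φ N))
        ≤ ∫⁻ w, ENNReal.ofReal (Mb + 1) * ENNReal.ofReal (Ystat σ Θ ū r w x) ∂(lawC σ a Θ ū N (Φ N)) := by
          refine lintegral_mono fun w => ?_
          rw [← ENNReal.ofReal_mul hM.le]
          exact ENNReal.ofReal_le_ofReal (abs_Xtil_sub_Xdet_le (hMd' s hs x) (hMp' s hs x))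
      _ = ENNReal.ofReal (Mb + 1) * ∫⁻ w, ENNReal.ofReal (Ystat σ Θ ū r w x) ∂(lawC σ a Θ ū N (Φ N)) :=
          lintegral_const_mul' _ _ ENNReal.ofReal_ne_top
      _ ≤ ENNReal.ofReal (Mb + 1) * ENNReal.ofReal κ := mul_le_mul_right (hY x) _
      _ = ENNReal.ofReal ((Mb + 1) * κ) := (ENNReal.ofReal_mul hM.le).symm
  have hMarkovG : lawC σ a Θ ū N (Φ N) {z | ENNReal.ofReal η ≤ g z} ≤ ENNReal.ofReal (δ / 2) := by
    have h1 := mul_meas_ge_le_lintegral₀ (μ := lawC σ a Θ ū N (Φ N)) hgm.aemeasurable (ENNReal.ofReal η)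
    have h2 : ENNReal.ofReal η * lawC σ a Θ ū N (Φ N) {z | ENNReal.ofReal η ≤ g z} ≤
        ENNReal.ofReal η * ENNReal.ofReal (δ / 2) := by
      rw [← ENNReal.ofReal_mul hη.le]
      exact h1.trans hL1
    exact (ENNReal.mul_le_mul_iff_right ((ENNReal.ofReal_pos.2 hη).ne') ENNReal.ofReal_ne_top).1 h2
  have hMarkov : lawC σ a Θ ū N (Φ N)
      {z | ENNReal.ofReal η ≤ ENNReal.ofReal |Itil σ r τ φ (Φ N) z - Idet σ Θ ū τ φ|} ≤ ENNReal.ofReal (δ / 2) := by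
    have hnull : lawC σ a Θ ū N (Φ N)
        {z | ¬ (ENNReal.ofReal |Itil σ r τ φ (Φ N) z - Idet σ Θ ū τ φ| ≤ g z)} = 0 := ae_iff.1 hgae
    calc lawC σ a Θ ū N (Φ N) {z | ENNReal.ofReal η ≤ ENNReal.ofReal |Itil σ r τ φ (Φ N) z - Idet σ Θ ū τ φ|}
        ≤ lawC σ a Θ ū N (Φ N) ({z | ENNReal.ofReal η ≤ g z} ∪
            {z | ¬ (ENNReal.ofReal |Itil σ r τ φ (Φ N) z - Idet σ Θ ū τ φ| ≤ g z)}) := by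
          refine measure_mono fun z hz => ?_
          by_cases h : ENNReal.ofReal |Itil σ r τ φ (Φ N) z - Idet σ Θ ū τ φ| ≤ g z
          · exact Or.inl (le_trans hz h)
          · exact Or.inr h
      _ ≤ lawC σ a Θ ū N (Φ N) {z | ENNReal.ofReal η ≤ g z} +
          lawC σ a Θ ū N (Φ N) {z | ¬ (ENNReal.ofReal |Itil σ r τ φ (Φ N) z - Idet σ Θ ū τ φ| ≤ g z)} :=
          measure_union_le _ _
      _ ≤ ENNReal.ofReal (δ / 2) + 0 := add_le_add hMarkovG hnull.le
      _ = ENNReal.ofReal (δ / 2) := add_zero _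
  -- the sup-density event and the law-null bad set of the flow
  have hD := HND N hND (Φ N)
  have hgood : lawC σ a Θ ū N (Φ N) (Φ N).goodᶜ = 0 := by
    have hac : lawC σ a Θ ū N (Φ N) ≪ liouville (Torus.geometry (Fin 3)) (N + 1) (hsDiameter σ N) :=
      withDensity_absolutelyContinuous _ _
    have hg : ∀ᵐ z ∂(lawC σ a Θ ū N (Φ N)), z ∈ (Φ N).good := hac.ae_le (Φ N).ae_mem_good
    exact mem_ae_iff.1 hg
  -- event inclusion: off the two bad events the crux functional is `Ĩ` and the boundary term is `−I_det`
  have hsub : {z | entropyFunctional σ r τ φ (Φ N) z + ∫ x : T3, Hs σ (ρ 0 x) (θ 0 x) * φ 0 x < -η} ⊆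
      (Φ N).goodᶜ ∪ {z | z ∈ (Φ N).good ∧ ∃ s ∈ Set.Icc (0 : ℝ) τ, ∃ x : T3, 2 < rhoC r ((Φ N).flow s z) x} ∪
        {z | ENNReal.ofReal η ≤ ENNReal.ofReal |Itil σ r τ φ (Φ N) z - Idet σ Θ ū τ φ|} := by
    intro z hz
    simp only [Set.mem_setOf_eq] at hz
    by_cases hg : z ∈ (Φ N).good
    · by_cases hDz : ∃ s ∈ Set.Icc (0 : ℝ) τ, ∃ x : T3, 2 < rhoC r ((Φ N).flow s z) x
      · exact Or.inl (Or.inr ⟨hg, hDz⟩)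
      · push Not at hDz
        refine Or.inr ?_
        simp only [Set.mem_setOf_eq]
        rw [entropyFunctional_eq_Itil φ (Φ N) hDz, hbdry] at hz
        refine ENNReal.ofReal_le_ofReal ?_
        have h1 : Itil σ r τ φ (Φ N) z - Idet σ Θ ū τ φ < -η := by rw [hdet]; linarith
        exact le_trans (by linarith) (neg_le_abs (Itil σ r τ φ (Φ N) z - Idet σ Θ ū τ φ))
    · exact Or.inl (Or.inl hg)
  calc lawC σ a Θ ū N (Φ N) {z | entropyFunctional σ r τ φ (Φ N) z + ∫ x : T3, Hs σ (ρ 0 x) (θ 0 x) * φ 0 x < -η}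
      ≤ lawC σ a Θ ū N (Φ N) ((Φ N).goodᶜ ∪
          {z | z ∈ (Φ N).good ∧ ∃ s ∈ Set.Icc (0 : ℝ) τ, ∃ x : T3, 2 < rhoC r ((Φ N).flow s z) x} ∪
          {z | ENNReal.ofReal η ≤ ENNReal.ofReal |Itil σ r τ φ (Φ N) z - Idet σ Θ ū τ φ|}) := measure_mono hsub
    _ ≤ lawC σ a Θ ū N (Φ N) ((Φ N).goodᶜ ∪
          {z | z ∈ (Φ N).good ∧ ∃ s ∈ Set.Icc (0 : ℝ) τ, ∃ x : T3, 2 < rhoC r ((Φ N).flow s z) x}) +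
        lawC σ a Θ ū N (Φ N) {z | ENNReal.ofReal η ≤ ENNReal.ofReal |Itil σ r τ φ (Φ N) z - Idet σ Θ ū τ φ|} :=
        measure_union_le _ _
    _ ≤ lawC σ a Θ ū N (Φ N) (Φ N).goodᶜ +
        lawC σ a Θ ū N (Φ N) {z | z ∈ (Φ N).good ∧ ∃ s ∈ Set.Icc (0 : ℝ) τ, ∃ x : T3, 2 < rhoC r ((Φ N).flow s z) x} +
        lawC σ a Θ ū N (Φ N) {z | ENNReal.ofReal η ≤ ENNReal.ofReal |Itil σ r τ φ (Φ N) z - Idet σ Θ ū τ φ|} :=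
        add_le_add (measure_union_le _ _) le_rfl
    _ ≤ 0 + ENNReal.ofReal (δ / 2) + ENNReal.ofReal (δ / 2) := add_le_add (add_le_add hgood.le hD) hMarkov
    _ = ENNReal.ofReal δ := by
        rw [zero_add, ← ENNReal.ofReal_add (by positivity) (by positivity)]
        congr 1
        ring

end Summit.AtomisticToContinuum.HydrodynamicLimit.Theorems.LocalSecondLawEquilibrium

end
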